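import Summits.SmoothPoincare4.SmoothPoincare4.Theorems.ConvexBisectionAcyclicBisectionExistsPageRotationCalculus
import HarnessLib

/-!
# The twisting pair vanishes exactly on the tangent direction: linear algebra of the page frame
(wave 3, brick (M3b-geo), pointwise part, of stub `stub_modelsOnFibred_of_reach` = NF4
`Literature.Topology.FourManifolds.LefschetzBase.modelsOnFibred_of_reach`, line `modp-braid-orbits`
r11, crux `ConvexBisection.AcyclicBisectionExists`, item stmt-SmoothPoincare4-10508; registered
sub-goal `helper_twistPair_eq_zero_iff`)

The page twisting of a framing `ν` of a loop `K` in `Base g ⊂ ℂ² = ℝ⁴` (`LefschetzBasePages.lean`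
§6) is the winding number of the twisting loop `t ↦ (⟪ν, i K'⟫, ⟪ν, n(K)⟫)`, `n = horizNormal g`
the horizontal normal (`dΦ(n) = i w`).  This file isolates the pointwise linear algebra behind
"the twisting loop of a framing of a page curve never vanishes" (the one hypothesis left in
`pageTwisting_comp_ambientIsotopy`, `…PageInvarianceTwisting.lean`):

* §1 the real inner product of `ℝ⁴` in the complex coordinates `cx`, `cy`
  (`inner_eq_re_herm`: `⟪V, U⟫ = Re ⟨V, U⟩_Herm`), `⟪V, iT⟫ = Im ⟨V, T⟩_Herm` (`inner_cplxJ`) and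
  `⟪V, n(q)⟫ = Im (w̄(q) dΦ_q(V)) / ‖dΦ_q‖²` (`inner_horizNormal`; `dΦ_q(V) = a x_V + b y_V`,
  `a = dPhiX g q`, `b = dPhiY q`);
* §2 `helper_twistPair_eq_zero_iff`: at `q ≠ 0` with `w(q) ≠ 0`, for `T ≠ 0` in the complex line
  `L = ker dΦ_q` (the tangent line of the page) and `V` tangent to the level set of `‖w‖²`
  (`Re (w̄ dΦ(V)) = 0`), the pair `(⟪V, iT⟫, ⟪V, n⟫)` vanishes iff `V ∈ ℝ · T` — the second
  component gives `Im (w̄ dΦ(V)) = 0`, hence `dΦ(V) = 0`, `V ∈ L = ℂ · T`, and then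
  `⟪V, iT⟫ = Im(c) ‖T‖²` for `V = c T` (the frame `(T, iT, n, -i n)` is real-orthogonal:
  `L ⊥ L^⊥`);
* §3 the directional derivatives this is fed with: `dw(γ') = dΦ(γ') = a x_{γ'} + b y_{γ'}`
  (`hasDerivAt_w_comp`) and, in the flat region `‖x‖² < 4` where `rho = ‖w‖²`,
  `d rho(γ') = 2 Re (w̄ dΦ(γ'))` (`hasDerivAt_rho_comp`, `fderiv_rho_apply_of_flat`, the flat case of
  `fderiv_rho_apply` of `…PageRotationCalculus.lean`) — so that "tangent to
  `∂ Base g = {rho = 1/4}`" is exactly the hypothesis on `V` of §2, and a loop inside one page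
  (`w ∘ γ ≡ c/2`) has velocity in `ker dΦ`.

The sequel `…PageTwistingTransverseLoop.lean` reads chart vectors of `Base g` in `ℝ⁴` through the
differential of the inclusion and concludes the loop form.  Everything is proved; no named facts,
no `sorry`.  Reference: J. B. Etnyre, T. Fuller, *Realizing 4-manifolds as achiral Lefschetz
fibrations*, IMRN 2006, §2 [EtnyreFuller2006] (page framing of a curve in a fibre).
-/

noncomputable section

set_option linter.dupNamespace false

open scoped Manifold ContDiff Topology ComplexConjugate
open Set Function Metric
open Literature.Topology.FourManifolds Literature.Topology.FourManifolds.LefschetzBase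

namespace Summit.SmoothPoincare4.SmoothPoincare4.Theorems.AcyclicBisectionExists.ModpBraidOrbits

variable {g : ℕ}

/-! ## §1 The real inner product of `ℝ⁴` in complex coordinates -/

/-- `⟪V, U⟫_ℝ = Re (x_V x̄_U + y_V ȳ_U)`: the real inner product of `ℝ⁴ = ℂ²` is the real part
of the standard Hermitian product. [folklore] -/
theorem inner_eq_re_herm (V U : EuclideanSpace ℝ (Fin 4)) :
    inner ℝ V U = (cx V * conj (cx U) + cy V * conj (cy U)).re := by
  simp only [PiLp.inner_apply, RCLike.inner_apply, conj_trivial, Fin.sum_univ_four, cx, cy,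
    Complex.add_re, Complex.mul_re, Complex.conj_re, Complex.conj_im]
  ring

/-- Two vectors of `ℝ⁴` with the same complex coordinates are equal. [folklore] -/
theorem ext_cx_cy {V U : EuclideanSpace ℝ (Fin 4)} (hx : cx V = cx U) (hy : cy V = cy U) :
    V = U := by
  rw [← mk_cx_cy V, hx, hy, mk_cx_cy]

/-- `cx (i v) = i · cx v`. [folklore] -/
@[simp] theorem cx_cplxJ (v : EuclideanSpace ℝ (Fin 4)) : cx (cplxJ v) = Complex.I * cx v := by
  simp [cplxJ]

/-- `cy (i v) = i · cy v`. [folklore] -/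
@[simp] theorem cy_cplxJ (v : EuclideanSpace ℝ (Fin 4)) : cy (cplxJ v) = Complex.I * cy v := by
  simp [cplxJ]

/-- **`⟪V, i T⟫ = Im (x_V x̄_T + y_V ȳ_T)`**: pairing with `i T` reads the imaginary part of the
Hermitian product. [folklore] -/
theorem inner_cplxJ (V T : EuclideanSpace ℝ (Fin 4)) :
    inner ℝ V (cplxJ T) = (cx V * conj (cx T) + cy V * conj (cy T)).im := by
  rw [inner_eq_re_herm, cx_cplxJ, cy_cplxJ]
  simp only [map_mul, Complex.conj_I, Complex.add_re, Complex.mul_re, Complex.neg_re,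
    Complex.I_re, Complex.neg_im, Complex.I_im, Complex.conj_re, Complex.conj_im,
    Complex.add_im, Complex.mul_im]
  ring

/-- `cx` of the horizontal normal. [folklore] -/
theorem cx_horizNormal (q : EuclideanSpace ℝ (Fin 4)) :
    cx (horizNormal g q) = Complex.I * w g q / ((‖dPhiX g q‖ ^ 2 + ‖dPhiY q‖ ^ 2 : ℝ) : ℂ) *
      conj (dPhiX g q) := by
  simp [horizNormal]

/-- `cy` of the horizontal normal. [folklore] -/
theorem cy_horizNormal (q : EuclideanSpace ℝ (Fin 4)) :
    cy (horizNormal g q) = Complex.I * w g q / ((‖dPhiX g q‖ ^ 2 + ‖dPhiY q‖ ^ 2 : ℝ) : ℂ) *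
      conj (dPhiY q) := by
  simp [horizNormal]

/-- **`⟪V, n(q)⟫ = Im (w̄(q) · dΦ_q(V)) / ‖dΦ_q‖²`**: pairing with the horizontal normal
`n = (i w/‖dΦ‖²) (ā, b̄)` reads (up to the positive factor `‖dΦ_q‖² = ‖a‖² + ‖b‖²`) the
imaginary part of `w̄ · dΦ(V)`, `dΦ(V) = a x_V + b y_V` — the angular component
`d(arg w)(V) · ‖w‖²`. [folklore] -/
theorem inner_horizNormal (V q : EuclideanSpace ℝ (Fin 4)) :
    inner ℝ V (horizNormal g q) =
      (conj (w g q) * (dPhiX g q * cx V + dPhiY q * cy V)).im /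
        (‖dPhiX g q‖ ^ 2 + ‖dPhiY q‖ ^ 2) := by
  rw [inner_eq_re_herm, cx_horizNormal, cy_horizNormal]
  set N : ℝ := ‖dPhiX g q‖ ^ 2 + ‖dPhiY q‖ ^ 2 with hN
  have key : cx V * conj (Complex.I * w g q / (N : ℂ) * conj (dPhiX g q)) +
      cy V * conj (Complex.I * w g q / (N : ℂ) * conj (dPhiY q)) =
      -Complex.I * (conj (w g q) * (dPhiX g q * cx V + dPhiY q * cy V)) / (N : ℂ) := by
    simp only [map_mul, map_div₀, Complex.conj_conj, Complex.conj_I, Complex.conj_ofReal]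
    ring
  rw [key, Complex.div_ofReal_re]
  congr 1
  simp only [Complex.mul_re, Complex.neg_re, Complex.I_re, Complex.I_im, zero_mul, zero_sub,
    neg_mul, one_mul, neg_neg]

/-- Off the origin one of the two coefficients of `dΦ = a dx + b dy` is non-zero. [folklore] -/
theorem dPhiX_ne_zero_or {q : EuclideanSpace ℝ (Fin 4)} (hq : q ≠ 0) :
    dPhiX g q ≠ 0 ∨ dPhiY q ≠ 0 := by
  by_cases ha : dPhiX g q = 0
  · refine Or.inr fun hb => normSq_dPhi_ne_zero (g := g) hq ?_
    rw [ha, hb, norm_zero]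
    ring
  · exact Or.inl ha

/-- `‖T‖²` as the Hermitian square `x_T x̄_T + y_T ȳ_T`. [folklore] -/
theorem ofReal_norm_sq_eq (T : EuclideanSpace ℝ (Fin 4)) :
    ((‖T‖ ^ 2 : ℝ) : ℂ) = cx T * conj (cx T) + cy T * conj (cy T) := by
  rw [norm_sq_eq, Complex.mul_conj, Complex.mul_conj, Complex.sq_norm, Complex.sq_norm]
  push_cast
  rfl

/-! ## §2 The twisting pair vanishes exactly on the real multiples of the tangent -/

/-- **Sub-goal `helper_twistPair_eq_zero_iff` of stub `stub_modelsOnFibred_of_reach`** (NF4, wave 3,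
brick (M3b-geo), pointwise linear algebra in `ℂ² = ℝ⁴`).  At a point `q ≠ 0` off the central page
(`w(q) ≠ 0`), let `T ≠ 0` lie in the complex tangent line `L = ker dΦ_q` of the page
(`a x_T + b y_T = 0`) and let `V` be tangent to the level set of `‖w‖²` through `q`
(`Re (w̄ · dΦ_q(V)) = 0`; in the flat region `‖x‖² < 4` this is the tangent space of `∂ Base g`).
Then the twisting pair `(⟪V, iT⟫, ⟪V, n(q)⟫)` vanishes iff `V ∈ ℝ · T`: the second component
forces `Im (w̄ dΦ(V)) = 0`, so `dΦ(V) = 0` and `V ∈ L = ℂ · T`, and then `⟪V, iT⟫ = Im(c) ‖T‖²`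
for `V = c T`.  (The four vectors `T, iT, n, −i n` are pairwise real-orthogonal: `L ⊥ L^⊥`.)
[cite: EtnyreFuller2006, §2] -/
theorem helper_twistPair_eq_zero_iff : ∀ (g : ℕ) (q V T : EuclideanSpace ℝ (Fin 4)), q ≠ 0 →
    Literature.Topology.FourManifolds.LefschetzBase.w g q ≠ 0 → T ≠ 0 →
    Literature.Topology.FourManifolds.LefschetzBase.dPhiX g q *
        Literature.Topology.FourManifolds.LefschetzBase.cx T +
      Literature.Topology.FourManifolds.LefschetzBase.dPhiY q *
        Literature.Topology.FourManifolds.LefschetzBase.cy T = 0 →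
    ((starRingEnd ℂ) (Literature.Topology.FourManifolds.LefschetzBase.w g q) *
      (Literature.Topology.FourManifolds.LefschetzBase.dPhiX g q *
          Literature.Topology.FourManifolds.LefschetzBase.cx V +
        Literature.Topology.FourManifolds.LefschetzBase.dPhiY q *
          Literature.Topology.FourManifolds.LefschetzBase.cy V)).re = 0 →
    ((inner ℝ V (Literature.Topology.FourManifolds.LefschetzBase.cplxJ T) = 0 ∧
      inner ℝ V (Literature.Topology.FourManifolds.LefschetzBase.horizNormal g q) = 0) ↔
      ∃ a : ℝ, V = a • T) := by
  intro g q V T hq hw hT hTL hV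
  have hN : ‖dPhiX g q‖ ^ 2 + ‖dPhiY q‖ ^ 2 ≠ 0 := normSq_dPhi_ne_zero hq
  constructor
  · rintro ⟨h1, h2⟩
    -- (1) `dΦ(V) = 0`
    rw [inner_horizNormal, div_eq_zero_iff] at h2
    have him : (conj (w g q) * (dPhiX g q * cx V + dPhiY q * cy V)).im = 0 := h2.resolve_right hN
    have hD : conj (w g q) * (dPhiX g q * cx V + dPhiY q * cy V) = 0 :=
      Complex.ext (by rw [hV, Complex.zero_re]) (by rw [him, Complex.zero_im])
    have hVL : dPhiX g q * cx V + dPhiY q * cy V = 0 :=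
      (mul_eq_zero.1 hD).resolve_left ((map_ne_zero _).2 hw)
    -- (2) `V` and `T` are `ℂ`-collinear: the `2 × 2` determinant vanishes
    have hdet : cx V * cy T - cx T * cy V = 0 := by
      rcases dPhiX_ne_zero_or (g := g) hq with ha | hb
      · have : dPhiX g q * (cx V * cy T - cx T * cy V) = dPhiX g q * 0 := by
          linear_combination (cy T) * hVL - (cy V) * hTL
        exact mul_left_cancel₀ ha this
      · have : dPhiY q * (cx V * cy T - cx T * cy V) = dPhiY q * 0 := by
          linear_combination (cx V) * hTL - (cx T) * hVL
        exact mul_left_cancel₀ hb this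
    -- (3) `‖T‖² V = H T` with `H = ⟨V, T⟩_Herm`, and `H` is real by `⟪V, iT⟫ = 0`
    set H : ℂ := cx V * conj (cx T) + cy V * conj (cy T) with hH
    have hHim : H.im = 0 := by rw [inner_cplxJ] at h1; exact h1
    have hm : (0 : ℝ) < ‖T‖ ^ 2 := by positivity
    have hmC := ofReal_norm_sq_eq T
    have hx : ((‖T‖ ^ 2 : ℝ) : ℂ) * cx V = H * cx T := by
      rw [hmC, hH]; linear_combination (conj (cy T)) * hdet
    have hy : ((‖T‖ ^ 2 : ℝ) : ℂ) * cy V = H * cy T := by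
      rw [hmC, hH]; linear_combination (-(conj (cx T))) * hdet
    have hHre : ((H.re : ℝ) : ℂ) = H := Complex.ext rfl (by rw [Complex.ofReal_im, hHim])
    have hm0 : ((‖T‖ ^ 2 : ℝ) : ℂ) ≠ 0 := by exact_mod_cast hm.ne'
    refine ⟨H.re / ‖T‖ ^ 2, ext_cx_cy ?_ ?_⟩
    · rw [cx_smul, Complex.ofReal_div, hHre]
      field_simp
      linear_combination hx
    · rw [cy_smul, Complex.ofReal_div, hHre]
      field_simp
      linear_combination hy
  · rintro ⟨a, rfl⟩
    rw [inner_cplxJ, inner_horizNormal, cx_smul, cy_smul]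
    constructor
    · have : (a : ℂ) * cx T * conj (cx T) + (a : ℂ) * cy T * conj (cy T) =
          ((a * ‖T‖ ^ 2 : ℝ) : ℂ) := by
        rw [Complex.ofReal_mul, ofReal_norm_sq_eq]
        ring
      rw [this, Complex.ofReal_im]
    · have : dPhiX g q * ((a : ℂ) * cx T) + dPhiY q * ((a : ℂ) * cy T) =
          a * (dPhiX g q * cx T + dPhiY q * cy T) := by ring
      rw [this, hTL, mul_zero, mul_zero, Complex.zero_im, zero_div]

/-! ## §3 Directional derivatives of `w` and `rho` -/

/-- Chain rule for the coordinate `x` along a curve. [folklore] -/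
theorem hasDerivAt_cx_comp {γ : ℝ → EuclideanSpace ℝ (Fin 4)} {γ' : EuclideanSpace ℝ (Fin 4)}
    {t : ℝ} (hγ : HasDerivAt γ γ' t) : HasDerivAt (fun s => cx (γ s)) (cx γ') t := by
  rw [cx_eq]
  exact cxL.hasFDerivAt.comp_hasDerivAt t hγ

/-- Chain rule for the coordinate `y` along a curve. [folklore] -/
theorem hasDerivAt_cy_comp {γ : ℝ → EuclideanSpace ℝ (Fin 4)} {γ' : EuclideanSpace ℝ (Fin 4)}
    {t : ℝ} (hγ : HasDerivAt γ γ' t) : HasDerivAt (fun s => cy (γ s)) (cy γ') t := by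
  rw [cy_eq]
  exact cyL.hasFDerivAt.comp_hasDerivAt t hγ

/-- **`dw(γ') = dΦ(γ') = a x_{γ'} + b y_{γ'}` along a curve**: the derivative of
`w ∘ γ = y² − x^{2g+1} − 1`. [folklore] -/
theorem hasDerivAt_w_comp {γ : ℝ → EuclideanSpace ℝ (Fin 4)} {γ' : EuclideanSpace ℝ (Fin 4)}
    {t : ℝ} (hγ : HasDerivAt γ γ' t) :
    HasDerivAt (fun s => w g (γ s)) (dPhiX g (γ t) * cx γ' + dPhiY (γ t) * cy γ') t := by
  have h := (((hasDerivAt_cy_comp hγ).pow 2).sub ((hasDerivAt_cx_comp hγ).pow (2 * g + 1))).sub_const 1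
  refine h.congr_deriv ?_
  simp only [dPhiX, dPhiY, Nat.add_sub_cancel, Nat.cast_ofNat, Nat.cast_add, Nat.cast_mul,
    Nat.cast_one]
  ring

/-- **`d rho(γ') = 2 Re (w̄ · dΦ(γ'))` along a curve in the flat region `‖x‖² < 4`** (where
`rho = ‖w‖²`, the cut-off `eta` being flat). [folklore] -/
theorem hasDerivAt_rho_comp {γ : ℝ → EuclideanSpace ℝ (Fin 4)} {γ' : EuclideanSpace ℝ (Fin 4)}
    {t : ℝ} (hγ : HasDerivAt γ γ' t) (hflat : ‖cx (γ t)‖ ^ 2 < 4) :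
    HasDerivAt (fun s => rho g (γ s))
      (2 * (conj (w g (γ t)) * (dPhiX g (γ t) * cx γ' + dPhiY (γ t) * cy γ')).re) t := by
  have h1 := hasDerivAt_norm_sq_comp (hasDerivAt_w_comp (g := g) hγ)
  have h2 : HasDerivAt (fun s => eta (‖cx (γ s)‖ ^ 2)) 0 t := by
    have hin := hasDerivAt_norm_sq_comp (hasDerivAt_cx_comp hγ)
    have h := (hasDerivAt_eta_of_lt hflat).comp t hin
    rw [zero_mul] at h
    exact h
  have h := h1.add h2
  rw [add_zero] at h
  exact h

/-- **The differential of `rho` in the flat region**: `d rho_q(V) = 2 Re (w̄(q) · dΦ_q(V))` for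
`‖x(q)‖² < 4` (the general formula `fderiv_rho_apply` of `…PageRotationCalculus.lean` with the
cut-off term `eta' = 0`). [folklore] -/
theorem fderiv_rho_apply_of_flat {q : EuclideanSpace ℝ (Fin 4)} (hflat : ‖cx q‖ ^ 2 < 4)
    (V : EuclideanSpace ℝ (Fin 4)) :
    fderiv ℝ (rho g) q V = 2 * (conj (w g q) * (dPhiX g q * cx V + dPhiY q * cy V)).re := by
  rw [fderiv_rho_apply g q V, fderiv_w_apply g q V, (hasDerivAt_eta_of_lt hflat).deriv, zero_mul,
    add_zero]

end Summit.SmoothPoincare4.SmoothPoincare4.Theorems.AcyclicBisectionExists.ModpBraidOrbits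

end
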